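import Summits.CriticalPhenomena.PercolationContinuityZ3.Theorems.PercNearOneGluingNoHeavySamePDefs
import Summits.CriticalPhenomena.PercolationContinuityZ3.Theorems.PercNearOneGluingNoHeavySamePZd
import HarnessLib

/-!
# The same-`p` witness input below density one, and its discharge for `ℤ^d`, `d ≥ 3`

builds on p205010 (kernel theorem, internal audit signed; external expert review pending).
Lane `prim-bschramm`, seat p4; memo `run/shared/lean/prim/bschramm/P4-GENERAL.md` §2.4/§7 (the caveat on
`SamePWitness`: it asks for a witness also at `p = 1`, where `θ = 1` and Kozma–Nitzan's construction is not
available; the closing argument only ever uses the witness at `p = p_c < 1`).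

* `SameP.SamePWitnessLtOne G x` — witnesses required only at densities `p < 1`;
* `SameP.theta_criticalProb_eq_zero_of_samePWitnessLtOne` — with `p_c(G,x) < 1` (the hypothesis of
  Benjamini–Schramm's Conj. 4) it gives `θ_x(p_c) = 0`, on any graph with countably many vertices;
* `SameP.samePWitnessLtOne_zd` — **the input HOLDS for `ℤ^d`, `d ≥ 3`** (Kozma–Nitzan §4 fed with the tree's
  theorem `CSH.kozmaNitzan_conjecture3_holds`, the uniform envelope bound, and the macro-to-micro lemma
  `KSch.mem_percolatesVia_of_infinite`): the first graph class of the lane's table with the input discharged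
  as a named theorem.
[cite: KozmaNitzan2024, §4 Theorem 6 (pp. 25–31)] [cite: BenjaminiSchramm1996, Conj. 4]
-/

noncomputable section

namespace Summit.CriticalPhenomena.PercolationContinuityZ3.Theorems

open MeasureTheory Literature.Probability.Percolation Literature.Probability.LatticeModels
open Literature.Probability.Percolation.KozmaNitzan HSiteScheme

namespace SameP

variable {V : Type*}

/-- **INPUT (FSW<1) — same-`p` finite-range witnesses at every percolating density below one.**  As
`SamePWitness`, restricted to `p < 1`. [cite: KozmaNitzan2024, §4 p. 25 (Definition of an exploration process)] -/
def SamePWitnessLtOne (G : SimpleGraph V) (x : V) : Prop :=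
  ∀ p : unitInterval, (p : ℝ) < 1 → 0 < theta G x p →
    ∃ (S : HSiteScheme V) (ε : ℝ) (N : ℕ), S.Lawful G p ε ∧ ε < (1 / 2) ^ 32 ∧
      (∀ h P, S.E.next h = some P → P.env.card ≤ N) ∧ (↑S.U₀ : Set (Sym2 V)) ⊆ G.edgeSet ∧
      S.initEvent ∩ {ω | (S.occFinal ω).Infinite} ⊆ percolatesAt x ∪ {ω | ¬ω ⊆ G.edgeSet}

/-- The unrestricted input implies the restricted one. [folklore] -/
theorem samePWitnessLtOne_of_samePWitness (G : SimpleGraph V) (x : V) (h : SamePWitness G x) :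
    SamePWitnessLtOne G x :=
  fun p _ hθ => h p hθ

/-- **INPUT below one + `p_c < 1` ⇒ no percolation at criticality** (any graph with countably many vertices).
[cite: KozmaNitzan2024, §1 p. 2 (approach 1)] [cite: BenjaminiSchramm1996, Conj. 4] -/
theorem theta_criticalProb_eq_zero_of_samePWitnessLtOne [Countable V] (G : SimpleGraph V) (x : V)
    (hpc : criticalProb G x < 1) (h : SamePWitnessLtOne G x) :
    theta G x ⟨criticalProb G x, criticalProb_mem_Icc G x⟩ = 0 := by
  by_contra hne
  have hpos : 0 < theta G x ⟨criticalProb G x, criticalProb_mem_Icc G x⟩ :=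
    lt_of_le_of_ne measureReal_nonneg (Ne.symm hne)
  have hp0 : 0 < criticalProb G x := by
    rcases (criticalProb_mem_Icc G x).1.eq_or_lt with h0 | h0
    · exfalso
      have e : (⟨criticalProb G x, criticalProb_mem_Icc G x⟩ : unitInterval) = 0 := Subtype.ext h0.symm
      rw [e, theta_bot] at hpos
      exact lt_irrefl _ hpos
    · exact h0
  obtain ⟨S, ε, N, hL, hε, hN, hU, hperc⟩ := h _ hpc hpos
  exact lt_irrefl _ (criticalProb_lt_of_lawful hL hε hN hU hp0 hperc)

/-- **The input holds for `ℤ^d`, `d ≥ 3`**: at every density `0 < p < 1` with `θ_{ℤ^d}(p) > 0`, Kozma–Nitzan's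
exploration scheme (with Conjecture 3 supplied by `CSH.kozmaNitzan_conjecture3_holds`) is a bounded-range
lawful witness forcing `0 ↔ ∞`. [cite: KozmaNitzan2024, §4 Theorem 6 (pp. 25–31)] -/
theorem samePWitnessLtOne_zd (d : ℕ) (hd : 3 ≤ d) : SamePWitnessLtOne (zdGraph d) (0 : Site d) := by
  haveI : NeZero d := ⟨by omega⟩
  intro p hp1 hθ
  have hp0 : 0 < (p : ℝ) := by
    rcases p.2.1.eq_or_lt with h0 | h0
    · exfalso
      have e : p = 0 := Subtype.ext h0.symm
      rw [e, theta_bot] at hθ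
      exact lt_irrefl _ hθ
    · exact h0
  obtain ⟨S, hSp, hδc, hL⟩ := exists_KSch_lawful hd p
    (targetProperty_of_conjecture3 CSH.kozmaNitzan_conjecture3_holds p hp0 hp1 hθ) hp1 hθ
  refine ⟨S.scheme, (1 / 2) ^ 33, 2 * d * (2 * (36 * S.C.r + 1) + 1) ^ d, hL, by norm_num,
    card_env_le_of_next S, fun e he => (mem_edgesIn_iff.1 (Finset.mem_coe.1 he)).1, ?_⟩
  rintro ω ⟨hA, hinf⟩
  by_cases hωE : ω ⊆ (zdGraph d).edgeSet
  · exact Or.inl (percolatesVia_subset_percolatesAt _ _ (S.mem_percolatesVia_of_infinite hδc hωE hA hinf))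
  · exact Or.inr hωE

end SameP

end Summit.CriticalPhenomena.PercolationContinuityZ3.Theorems

end
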